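import Literature.NumberTheory.Automorphic.InfUnitaryLocalExponentialOperator
import Literature.NumberTheory.Automorphic.InfUnitaryHilbertCompletionKAction
import Literature.NumberTheory.Automorphic.GKModulesOneParameter
import HarnessLib

/-!
# The one-parameter unitary groups `U K X s = exp(s ρ X)` of an infinitesimally unitary `(𝔤, K)`-module with analytic vectors, I

Topic `NumberTheory/Automorphic`; namespace `Literature.NumberTheory.Automorphic.IsPosDefHerm` (dot notation on `hB : IsPosDefHerm B`); sequel of ★
`InfUnitaryLocalExponentialOperator` (`expOp`); sequel file `InfUnitaryOneParameterGroupDeriv` ((U3)–(U5), (U7)).  Cell `hodgecm-mathlib`, F0∕P3,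
ROAD-GLOB to the letter A6 #92 `HasUnitaryGlobalizationOfInfUnitary` [KnappVogan1995, Thm. 0.6 (a)] at `U(2,1)`, brick **P2** (LEAD amendments v1.1
(e): EXPORT (U1)–(U7)).  Two definitions WITH BODIES (`uSteps`, `U`) + theorems; no named fact, no instance, no notation, no `sorry`.

THE MATHEMATICS ([HarishChandra1953, §9]; [Nelson1959, §2]; [KnappVogan1995, Introduction Thm. 0.6]).  Let `G` be a linear real group, `(V, B)` a
complex vector space with a positive definite Hermitian form, `ρ : 𝔤 →ₗ⁅ℝ⁆ End V` with every `ρ X` `B`-skew, and suppose the LINE BOUNDS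
`‖emb ((ρ X)ⁿ v)‖ ≤ C_v · n! · (K‖X‖)ⁿ` (a consequence of the factorial bound (FB) on words, `lineBound_of_FB`; `‖X‖` = the operator norm of the
matrix `X`, `Matrix.Norms.Operator`, as ★ `GKModules`).  For `X ∈ 𝔤` and `s ∈ ℝ` put **`U K X s := (expOp (ρ X) (K‖X‖) (s∕n))ⁿ`** with
`n = uSteps K X s = ⌈16 |s| K‖X‖⌉ + 1` (so each factor is a genuine unitary of ★ `expOp`).  Then: the definition does not depend on the
admissible subdivision (`U_eq_pow`; refinement `(expOp (a∕m))ᵐ = (expOp (a∕(mm′)))^{mm′}`, ★ `expOp_pow`) nor on the admissible bound constant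
(`expOp_congr_K`); `U K X s (emb v) = expVec (ρ X) s v` for small `s` (`U_emb`); **(U1)** `U K X 0 = 1`, `U K X (s+t) = U K X s ∘ U K X t` (`U_add`,
via a common fine subdivision and the local group law ★ `expOp_comp`); **(U2)** `U K X s` is unitary (`U_mem_unitary`, `norm_U`); **(U6)**
`U K (c • X) s = U K X (c s)` (`U_smul`; rescaling `expVec (c • Z) a v = expVec Z (c a) v`).

HONEST LABEL: brick P2 of the road; closes no registered stub.  HC_CM is proved only modulo the 2 remaining named inputs (hLiu418, h413) until rung 0 closes.

## Mathlib ∕ tree search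
Mathlib: `Nat.ceil`, `Commute.mul_pow`, `pow_mem` (unitary submonoid), `SemiconjBy`.  Tree: ★ `InfUnitaryLocalExponential(Operator)` (`expVec`, `expOp`,
`expOp_comp`, `expOp_pow`, `expOp_mem_unitary`, `expOp_emb`), ★ `InfUnitaryHilbertCompletion(KAction)`.  Dedup: `rg "uSteps|def U "` over
`Literature/NumberTheory/Automorphic/InfUnitary*` — no hits.

## References
* Harish-Chandra, *Representations of a semisimple Lie group on a Banach space. I*, Trans. AMS 75 (1953), §9 [HarishChandra1953].
* E. Nelson, *Analytic vectors*, Ann. of Math. 70 (1959), §2 [Nelson1959].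
* A. W. Knapp, D. A. Vogan, *Cohomological Induction and Unitary Representations* (1995), Introduction (0.5), Thm. 0.6 [KnappVogan1995].
-/

set_option autoImplicit false

noncomputable section

-- Mathlib idiom (as in ★ `GKModules`): the commutator bracket on `Module.End ℂ V`, to MENTION `ρ : 𝔤 →ₗ⁅ℝ⁆ End V`.
attribute [local instance 100] LieRing.ofAssociativeRing

open Finset
open scoped Nat InnerProductSpace ComplexConjugate Matrix.Norms.Operator

namespace Literature.NumberTheory.Automorphic

namespace IsPosDefHerm

universe u

variable {A : Type*} [NormedCommRing A] [NormedAlgebra ℝ A] [NormedAlgebra ℚ A] [CompleteSpace A]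
  [StarRing A] {N : Type*} [Fintype N] [DecidableEq N] {G : RealMatrixGroup A N}
  {V : Type u} [AddCommGroup V] [Module ℂ V] {B : V →ₗ⋆[ℂ] V →ₗ[ℂ] ℂ} (hB : IsPosDefHerm B)
include hB

/-! ## §1 Single-operator lemmas: rescaling the operator, independence of the bound constant -/

section Rescale

variable (Z : V →ₗ[ℂ] V)

/-- **Rescaling the operator rescales time**: `expVec (c • Z) a v = expVec Z (c a) v` (`c` real; termwise `(cZ)ⁿ = cⁿ Zⁿ`). [cite: Nelson1959, §2] -/
theorem expVec_smul_op (c a : ℝ) (v : V) : hB.expVec ((c : ℂ) • Z) a v = hB.expVec Z (c * a) v := by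
  unfold expVec
  refine tsum_congr fun n => ?_
  rw [smul_pow, LinearMap.smul_apply, map_smul, ← Complex.ofReal_pow, RCLike.real_smul_eq_coe_smul (K := ℂ) (a ^ n / (n ! : ℝ)),
    RCLike.real_smul_eq_coe_smul (K := ℂ) ((c * a) ^ n / (n ! : ℝ)), smul_smul]
  congr 1
  rw [RCLike.ofReal_eq_complex_ofReal]
  push_cast
  ring

/-- Factorial bounds for `c • Z` from those for `Z` (constant `|c| K`). [cite: Nelson1959, §2] -/
theorem bound_smul_op {K C : ℝ} {v : V} (hv : ∀ n, ‖hB.emb ((Z ^ n) v)‖ ≤ C * n ! * K ^ n) (c : ℝ) (n : ℕ) :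
    ‖hB.emb ((((c : ℂ) • Z) ^ n) v)‖ ≤ C * n ! * (|c| * K) ^ n := by
  rw [smul_pow, LinearMap.smul_apply, map_smul, norm_smul, norm_pow, Complex.norm_real, Real.norm_eq_abs, mul_pow]
  calc |c| ^ n * ‖hB.emb ((Z ^ n) v)‖ ≤ |c| ^ n * (C * n ! * K ^ n) := by gcongr; exact hv n
    _ = C * n ! * (|c| ^ n * K ^ n) := by ring

omit hB in
/-- `c • Z` is `B`-skew if `Z` is (`c` real). [cite: KnappVogan1995, Introduction (0.5)] -/
theorem skew_smul_op (hZ : ∀ x y, B (Z x) y = -B x (Z y)) (c : ℝ) (x y : V) :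
    B (((c : ℂ) • Z) x) y = -B x (((c : ℂ) • Z) y) := by
  rw [LinearMap.smul_apply, LinearMap.smul_apply, LinearMap.map_smulₛₗ, LinearMap.smul_apply, map_smul, hZ,
    Complex.conj_ofReal, smul_neg]

/-- **Independence of the bound constant**: `expOp Z K₁ a = expOp Z K₂ a` when both parameter sets are admissible. [cite: HarishChandra1953, §9] -/
theorem expOp_congr_K (hZ : ∀ x y, B (Z x) y = -B x (Z y)) {K₁ K₂ : ℝ} (hK₁ : 0 ≤ K₁) (hK₂ : 0 ≤ K₂)
    (hZb₁ : ∀ v : V, ∃ C : ℝ, ∀ n, ‖hB.emb ((Z ^ n) v)‖ ≤ C * n ! * K₁ ^ n)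
    (hZb₂ : ∀ v : V, ∃ C : ℝ, ∀ n, ‖hB.emb ((Z ^ n) v)‖ ≤ C * n ! * K₂ ^ n) {a : ℝ} (ha₁ : 2 * |a| * K₁ < 1)
    (ha₂ : 2 * |a| * K₂ < 1) : hB.expOp Z K₁ a = hB.expOp Z K₂ a :=
  hB.eq_of_forall_emb fun v => by rw [hB.expOp_emb Z hZ hK₁ hZb₁ ha₁, hB.expOp_emb Z hZ hK₂ hZb₂ ha₂]

/-- **Rescaling at the operator level**: `expOp (c • Z) K₁ a = expOp Z K₂ (c a)` when both sides are admissible. [cite: HarishChandra1953, §9] -/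
theorem expOp_smul_op (hZ : ∀ x y, B (Z x) y = -B x (Z y)) {K₁ K₂ : ℝ} (hK₁ : 0 ≤ K₁) (hK₂ : 0 ≤ K₂) (c : ℝ)
    (hZb₁ : ∀ v : V, ∃ C : ℝ, ∀ n, ‖hB.emb ((((c : ℂ) • Z) ^ n) v)‖ ≤ C * n ! * K₁ ^ n)
    (hZb₂ : ∀ v : V, ∃ C : ℝ, ∀ n, ‖hB.emb ((Z ^ n) v)‖ ≤ C * n ! * K₂ ^ n) {a : ℝ} (ha₁ : 2 * |a| * K₁ < 1)
    (ha₂ : 2 * |c * a| * K₂ < 1) : hB.expOp ((c : ℂ) • Z) K₁ a = hB.expOp Z K₂ (c * a) :=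
  hB.eq_of_forall_emb fun v => by
    rw [hB.expOp_emb _ (skew_smul_op Z hZ c) hK₁ hZb₁ ha₁, hB.expOp_emb Z hZ hK₂ hZb₂ ha₂, hB.expVec_smul_op]

/-- **Refinement**: `(expOp Z K (a∕m))^m` does not depend on the admissible `m`: `(expOp Z K (a∕m))^m = (expOp Z K (a∕(m m′)))^{m m′}`.
[cite: Nelson1959, §2] -/
theorem expOp_div_pow_eq (hZ : ∀ x y, B (Z x) y = -B x (Z y)) {K : ℝ} (hK : 0 ≤ K)
    (hZb : ∀ v : V, ∃ C : ℝ, ∀ n, ‖hB.emb ((Z ^ n) v)‖ ≤ C * n ! * K ^ n) (a : ℝ) {m m' : ℕ} (hm : 0 < m) (hm' : 0 < m')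
    (ha : 4 * (|a| / m) * K < 1) :
    hB.expOp Z K (a / m) ^ m = hB.expOp Z K (a / (m * m')) ^ (m * m') := by
  have hmr : (0 : ℝ) < m := by exact_mod_cast hm
  have hmr' : (0 : ℝ) < m' := by exact_mod_cast hm'
  have h := hB.expOp_pow Z hZ hK hZb (a := a / (m * m')) m' (by
    rw [abs_div, abs_mul, Nat.abs_cast, Nat.abs_cast]
    calc 4 * (m' * (|a| / (m * m'))) * K = 4 * (|a| / m) * K := by field_simp
      _ < 1 := ha)
  rw [mul_comm m m', pow_mul, h]
  congr 2
  field_simp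

end Rescale

/-! ## §2 From the factorial bound (FB) on words to bounds along a line -/

variable (ρ : G.lie →ₗ⁅ℝ⁆ Module.End ℂ V)

/-- **(FB) ⇒ line bounds**: `‖emb ((ρ X)ⁿ v)‖ ≤ C_v · n! · (K ‖X‖)ⁿ` (the word `X, …, X`). [cite: Nelson1959, §2] -/
theorem lineBound_of_FB {K : ℝ}
    (hFB : ∀ v : V, ∃ C : ℝ, ∀ (m : ℕ) (X : Fin m → G.lie),
      ‖hB.emb ((List.ofFn fun i => (ρ (X i) : V →ₗ[ℂ] V)).prod v)‖ ≤ C * m ! * K ^ m * ∏ i, ‖((X i : G.lie) : Matrix N N A)‖)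
    (X : G.lie) (v : V) : ∃ C : ℝ, ∀ n, ‖hB.emb (((ρ X : V →ₗ[ℂ] V) ^ n) v)‖ ≤ C * n ! * (K * ‖(X : Matrix N N A)‖) ^ n := by
  obtain ⟨C, hC⟩ := hFB v
  refine ⟨C, fun n => ?_⟩
  have h := hC n (fun _ => X)
  rw [List.ofFn_const, List.prod_replicate, Finset.prod_const, Finset.card_univ, Fintype.card_fin] at h
  calc ‖hB.emb (((ρ X : V →ₗ[ℂ] V) ^ n) v)‖ ≤ C * n ! * K ^ n * ‖(X : Matrix N N A)‖ ^ n := h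
    _ = C * n ! * (K * ‖(X : Matrix N N A)‖) ^ n := by rw [mul_pow]; ring

/-- Line bounds TRANSPORT along a `B`-isometric surjective intertwiner `u` (`u ∘ Z = Z′ ∘ u`): bounds for `Z` with constant `K` give bounds for
`Z′` with the SAME constant. [cite: HarishChandra1953, §9] -/
theorem lineBound_transport {Z Z' u : V →ₗ[ℂ] V} (hiso : ∀ x y, B (u x) (u y) = B x y) (hsurj : Function.Surjective u)
    (hcomm : u ∘ₗ Z = Z' ∘ₗ u) {K : ℝ} (hZb : ∀ v : V, ∃ C : ℝ, ∀ n, ‖hB.emb ((Z ^ n) v)‖ ≤ C * n ! * K ^ n) (w : V) :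
    ∃ C : ℝ, ∀ n, ‖hB.emb ((Z' ^ n) w)‖ ≤ C * n ! * K ^ n := by
  obtain ⟨v, rfl⟩ := hsurj w
  obtain ⟨C, hC⟩ := hZb v
  refine ⟨C, fun n => ?_⟩
  have hpow : (Z' ^ n) (u v) = u ((Z ^ n) v) := by
    induction n with
    | zero => simp
    | succ n ih =>
      rw [pow_succ', pow_succ', Module.End.mul_apply, Module.End.mul_apply, ih]
      exact (LinearMap.congr_fun hcomm ((Z ^ n) v)).symm
  rw [hpow, hB.norm_emb_map_of_isometric hiso]
  exact hC n

/-! ## §3 The one-parameter unitary groups `U K X s` -/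

/-- The number of subdivision steps: `⌈16 |s| K ‖X‖⌉ + 1` (so that `8 |s∕n| K‖X‖ ≤ 1∕2`). [cite: Nelson1959, §2] -/
def uSteps (K : ℝ) (X : G.lie) (s : ℝ) : ℕ := ⌈16 * |s| * (K * ‖(X : Matrix N N A)‖)⌉₊ + 1

/-- **`U K X s := (expOp (ρ X) (K‖X‖) (s ∕ n))ⁿ`, `n = uSteps K X s`** — the unitary one-parameter group generated by the closure of `ρ X`
(for `X ∈ 𝔤`), as a bounded operator on `E`; junk unless `ρ X` is `B`-skew with line bounds at constant `K‖X‖`. [cite: HarishChandra1953, §9]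
[cite: Nelson1959, §2] -/
def U (K : ℝ) (X : G.lie) (s : ℝ) : hB.E →L[ℂ] hB.E :=
  hB.expOp (ρ X : V →ₗ[ℂ] V) (K * ‖(X : Matrix N N A)‖) (s / uSteps K X s) ^ uSteps K X s

omit hB in
/-- `uSteps` is positive. [cite: Nelson1959, §2] -/
theorem uSteps_pos (K : ℝ) (X : G.lie) (s : ℝ) : 0 < uSteps (N := N) K X s := Nat.succ_pos _

omit hB in
/-- The basic smallness `8 · (|s| ∕ uSteps) · (K‖X‖) < 1`. [cite: Nelson1959, §2] -/
theorem small_uSteps {K : ℝ} (hK : 0 ≤ K) (X : G.lie) (s : ℝ) :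
    8 * (|s| / uSteps (N := N) K X s) * (K * ‖(X : Matrix N N A)‖) < 1 := by
  set L := K * ‖(X : Matrix N N A)‖ with hL
  have hL0 : 0 ≤ L := by positivity
  have hn : (16 * |s| * L : ℝ) < (uSteps (N := N) K X s : ℝ) := by
    unfold uSteps
    push_cast
    exact lt_of_le_of_lt (Nat.le_ceil _) (by linarith)
  have hnpos : (0 : ℝ) < (uSteps (N := N) K X s : ℝ) := by exact_mod_cast uSteps_pos K X s
  have e : 8 * (|s| / (uSteps (N := N) K X s : ℝ)) * L = (8 * |s| * L) / (uSteps (N := N) K X s : ℝ) := by ring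
  rw [e, div_lt_one hnpos]
  nlinarith [abs_nonneg s]

variable {ρ}

/-- **Independence of the subdivision**: `U K X s = (expOp (ρ X) (K‖X‖) (s∕m))ᵐ` for every `m > 0` with `4 (|s|∕m) K‖X‖ < 1`.
[cite: Nelson1959, §2] -/
theorem U_eq_pow {K : ℝ} (hK : 0 ≤ K) {X : G.lie} (hX : ∀ x y, B (ρ X x) y = -B x (ρ X y))
    (hb : ∀ v : V, ∃ C : ℝ, ∀ n, ‖hB.emb (((ρ X : V →ₗ[ℂ] V) ^ n) v)‖ ≤ C * n ! * (K * ‖(X : Matrix N N A)‖) ^ n)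
    (s : ℝ) {m : ℕ} (hm : 0 < m) (hsm : 4 * (|s| / m) * (K * ‖(X : Matrix N N A)‖) < 1) :
    hB.U ρ K X s = hB.expOp (ρ X : V →ₗ[ℂ] V) (K * ‖(X : Matrix N N A)‖) (s / m) ^ m := by
  have hL : 0 ≤ K * ‖(X : Matrix N N A)‖ := by positivity
  have h1 := hB.expOp_div_pow_eq (ρ X : V →ₗ[ℂ] V) hX hL hb s (uSteps_pos K X s) hm
    (by linarith [small_uSteps (N := N) hK X s, show 0 ≤ (|s| / uSteps (N := N) K X s) * (K * ‖(X : Matrix N N A)‖) by positivity])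
  have h2 := hB.expOp_div_pow_eq (ρ X : V →ₗ[ℂ] V) hX hL hb s hm (uSteps_pos K X s) hsm
  unfold U
  rw [h1, h2, mul_comm (m : ℝ) _, Nat.mul_comm m _]

/-- For small time no subdivision is needed: `U K X s = expOp (ρ X) (K‖X‖) s` when `4|s|K‖X‖ < 1`. [cite: Nelson1959, §2] -/
theorem U_eq_expOp {K : ℝ} (hK : 0 ≤ K) {X : G.lie} (hX : ∀ x y, B (ρ X x) y = -B x (ρ X y))
    (hb : ∀ v : V, ∃ C : ℝ, ∀ n, ‖hB.emb (((ρ X : V →ₗ[ℂ] V) ^ n) v)‖ ≤ C * n ! * (K * ‖(X : Matrix N N A)‖) ^ n)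
    {s : ℝ} (hs : 4 * |s| * (K * ‖(X : Matrix N N A)‖) < 1) :
    hB.U ρ K X s = hB.expOp (ρ X : V →ₗ[ℂ] V) (K * ‖(X : Matrix N N A)‖) s := by
  rw [hB.U_eq_pow hK hX hb s Nat.one_pos (by simpa using hs), Nat.cast_one, div_one, pow_one]

/-- **`U K X s (emb v) = expVec (ρ X) s v`** for `4|s|K‖X‖ < 1`. [cite: HarishChandra1953, §9] -/
theorem U_emb {K : ℝ} (hK : 0 ≤ K) {X : G.lie} (hX : ∀ x y, B (ρ X x) y = -B x (ρ X y))
    (hb : ∀ v : V, ∃ C : ℝ, ∀ n, ‖hB.emb (((ρ X : V →ₗ[ℂ] V) ^ n) v)‖ ≤ C * n ! * (K * ‖(X : Matrix N N A)‖) ^ n)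
    {s : ℝ} (hs : 4 * |s| * (K * ‖(X : Matrix N N A)‖) < 1) (v : V) :
    hB.U ρ K X s (hB.emb v) = hB.expVec (ρ X : V →ₗ[ℂ] V) s v := by
  rw [hB.U_eq_expOp hK hX hb hs, hB.expOp_emb _ hX (by positivity) hb (by nlinarith [abs_nonneg s, hs])]

/-- **(U1) `U K X 0 = 1`.** [cite: HarishChandra1953, §9] -/
theorem U_zero {K : ℝ} (hK : 0 ≤ K) {X : G.lie} (hX : ∀ x y, B (ρ X x) y = -B x (ρ X y))
    (hb : ∀ v : V, ∃ C : ℝ, ∀ n, ‖hB.emb (((ρ X : V →ₗ[ℂ] V) ^ n) v)‖ ≤ C * n ! * (K * ‖(X : Matrix N N A)‖) ^ n) :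
    hB.U ρ K X 0 = 1 := by
  rw [hB.U_eq_expOp hK hX hb (by simp), hB.expOp_zero _ hX (by positivity) hb]

/-- **(U1) THE GROUP LAW `U K X (s + t) = U K X s ∘ U K X t`.** [cite: HarishChandra1953, §9] [cite: Nelson1959, §2] -/
theorem U_add {K : ℝ} (hK : 0 ≤ K) {X : G.lie} (hX : ∀ x y, B (ρ X x) y = -B x (ρ X y))
    (hb : ∀ v : V, ∃ C : ℝ, ∀ n, ‖hB.emb (((ρ X : V →ₗ[ℂ] V) ^ n) v)‖ ≤ C * n ! * (K * ‖(X : Matrix N N A)‖) ^ n) (s t : ℝ) :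
    hB.U ρ K X (s + t) = hB.U ρ K X s ∘L hB.U ρ K X t := by
  set L := K * ‖(X : Matrix N N A)‖ with hL
  have hL0 : 0 ≤ L := by positivity
  -- a common admissible subdivision
  set m : ℕ := ⌈16 * (|s| + |t|) * L⌉₊ + 1 with hm
  have hmpos : 0 < m := Nat.succ_pos _
  have hmr : (0 : ℝ) < m := by exact_mod_cast hmpos
  have hmge : 16 * (|s| + |t|) * L < m := by
    rw [hm]; push_cast; exact lt_of_le_of_lt (Nat.le_ceil _) (by linarith)
  have key : 4 * ((|s| + |t|) / m) * L < 1 := by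
    have e : 4 * ((|s| + |t|) / (m : ℝ)) * L = (4 * (|s| + |t|) * L) / (m : ℝ) := by ring
    rw [e, div_lt_one hmr]; nlinarith [abs_nonneg s, abs_nonneg t]
  have hs : 4 * (|s| / m) * L < 1 := lt_of_le_of_lt (by gcongr; linarith [abs_nonneg t]) key
  have ht : 4 * (|t| / m) * L < 1 := lt_of_le_of_lt (by gcongr; linarith [abs_nonneg s]) key
  have hst : 4 * (|s + t| / m) * L < 1 := lt_of_le_of_lt (by gcongr; exact abs_add_le s t) key
  rw [hB.U_eq_pow hK hX hb (s + t) hmpos hst, hB.U_eq_pow hK hX hb s hmpos hs, hB.U_eq_pow hK hX hb t hmpos ht]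
  have hcomp := hB.expOp_comp (ρ X : V →ₗ[ℂ] V) hX hL0 hb (a := s / m) (b := t / m)
    (by rw [abs_div, abs_div, Nat.abs_cast, ← add_div]; exact key)
  rw [add_div, ← hcomp, ← ContinuousLinearMap.mul_def, ← ContinuousLinearMap.mul_def]
  refine (Commute.mul_pow ?_ m)
  -- the two factors commute (both orders equal `expOp ((s+t)/m)`)
  have hcomp' := hB.expOp_comp (ρ X : V →ₗ[ℂ] V) hX hL0 hb (a := t / m) (b := s / m)
    (by rw [abs_div, abs_div, Nat.abs_cast, ← add_div, add_comm]; exact key)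
  change hB.expOp _ L (s / m) * hB.expOp _ L (t / m) = hB.expOp _ L (t / m) * hB.expOp _ L (s / m)
  rw [ContinuousLinearMap.mul_def, ContinuousLinearMap.mul_def, hcomp, hcomp', add_comm]

/-- **(U2) `U K X s` is unitary.** [cite: HarishChandra1953, §9] -/
theorem U_mem_unitary {K : ℝ} (hK : 0 ≤ K) {X : G.lie} (hX : ∀ x y, B (ρ X x) y = -B x (ρ X y))
    (hb : ∀ v : V, ∃ C : ℝ, ∀ n, ‖hB.emb (((ρ X : V →ₗ[ℂ] V) ^ n) v)‖ ≤ C * n ! * (K * ‖(X : Matrix N N A)‖) ^ n) (s : ℝ) :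
    hB.U ρ K X s ∈ unitary (hB.E →L[ℂ] hB.E) := by
  unfold U
  refine pow_mem (hB.expOp_mem_unitary _ hX (by positivity) hb ?_) _
  have := small_uSteps (N := N) hK X s
  rw [abs_div, Nat.abs_cast]
  linarith

/-- `‖U K X s z‖ = ‖z‖`. [cite: HarishChandra1953, §9] -/
theorem norm_U {K : ℝ} (hK : 0 ≤ K) {X : G.lie} (hX : ∀ x y, B (ρ X x) y = -B x (ρ X y))
    (hb : ∀ v : V, ∃ C : ℝ, ∀ n, ‖hB.emb (((ρ X : V →ₗ[ℂ] V) ^ n) v)‖ ≤ C * n ! * (K * ‖(X : Matrix N N A)‖) ^ n) (s : ℝ)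
    (z : hB.E) : ‖hB.U ρ K X s z‖ = ‖z‖ :=
  ContinuousLinearMap.norm_map_of_mem_unitary (hB.U_mem_unitary hK hX hb s) z

/-- **(U6) RESCALING `U K (c • X) s = U K X (c s)`.** [cite: Nelson1959, §2] -/
theorem U_smul {K : ℝ} (hK : 0 ≤ K) {X : G.lie} (hX : ∀ x y, B (ρ X x) y = -B x (ρ X y))
    (hb : ∀ v : V, ∃ C : ℝ, ∀ n, ‖hB.emb (((ρ X : V →ₗ[ℂ] V) ^ n) v)‖ ≤ C * n ! * (K * ‖(X : Matrix N N A)‖) ^ n) (c s : ℝ) :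
    hB.U ρ K (c • X) s = hB.U ρ K X (c * s) := by
  have hρ : (ρ (c • X) : V →ₗ[ℂ] V) = (c : ℂ) • (ρ X : V →ₗ[ℂ] V) := by rw [map_smul, Complex.coe_smul]
  have hnorm : ‖((c • X : G.lie) : Matrix N N A)‖ = |c| * ‖(X : Matrix N N A)‖ := by
    rw [show ((c • X : G.lie) : Matrix N N A) = c • (X : Matrix N N A) from rfl, norm_smul, Real.norm_eq_abs]
  have hsteps : uSteps (N := N) K (c • X) s = uSteps (N := N) K X (c * s) := by
    unfold uSteps; rw [hnorm, abs_mul]; ring_nf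
  have hL : 0 ≤ K * ‖(X : Matrix N N A)‖ := by positivity
  have hbc : ∀ v : V, ∃ C : ℝ, ∀ n, ‖hB.emb ((((c : ℂ) • (ρ X : V →ₗ[ℂ] V)) ^ n) v)‖ ≤ C * n ! * (K * ‖((c • X : G.lie) : Matrix N N A)‖) ^ n := by
    intro v; obtain ⟨C, hC⟩ := hb v
    refine ⟨C, fun n => ?_⟩
    rw [hnorm, show K * (|c| * ‖(X : Matrix N N A)‖) = |c| * (K * ‖(X : Matrix N N A)‖) by ring]
    exact hB.bound_smul_op _ hC c n
  unfold U
  rw [hsteps, hρ]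
  set n := uSteps (N := N) K X (c * s)
  have hsmall := small_uSteps (N := N) hK X (c * s)
  rw [hB.expOp_smul_op (ρ X : V →ₗ[ℂ] V) hX (by positivity) hL c hbc hb]
  · rw [mul_div_assoc]
  · rw [hnorm, abs_div, Nat.abs_cast]
    have : 2 * (|s| / n) * (K * (|c| * ‖(X : Matrix N N A)‖)) = 2 * (|c * s| / n) * (K * ‖(X : Matrix N N A)‖) := by
      rw [abs_mul]; ring
    rw [this]; linarith
  · rw [show c * (s / (n : ℝ)) = c * s / n by ring, abs_div, Nat.abs_cast]; linarith

end IsPosDefHerm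

end Literature.NumberTheory.Automorphic

end
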